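import Summits.Langlands.Langlands.Theses.RamifiedCoefficientSeed
import Summits.Langlands.Langlands.Statement
import Summits.Langlands.Langlands.Theorems.SectorComplement.Negative.RamifiedCoefficientSeedSectorComplementPosition
import Summits.Langlands.Langlands.Theorems.RamifiedCoefficientSeedSectorComplementJunctionOfR
import Summits.Langlands.Langlands.Theorems.RamifiedCoefficientSeedAdjointLiftingGL3StubAutomorphyLifting
import Summits.Langlands.Langlands.Theorems.RamifiedCoefficientSeedAdjointLiftingGL3StubUntwist
import Summits.Langlands.Langlands.Theorems.RamifiedCoefficientSeedAdjointLiftingGL3StubAdjointResidualImage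
import HarnessLib.Audit.CruxProbe

/-! BC7 / BC2 re-probe of `RamifiedCoefficientSeed.AdjointLiftingGL3` (stmt-Langlands-16779), equivalence audit
2026-08-17 (cstrat q1), with every Theorems file of the route landed since the 08:29Z probe in scope (the position
lemmas incl. the trigger `ramifiedCoefficientSeed_langlands_iff_engine_and_frame`, JunctionOfR, the landed stubs A/D
and the B-glue), so that `exact?` in P1/P5 sees them. -/

set_option h21.cruxProbe.batteryMs 90000
set_option h21.cruxProbe.totalMs 300000

#h21_crux_probe Summit.Langlands.Langlands.Theses.RamifiedCoefficientSeed.AdjointLiftingGL3 route := "route-Langlands-RamifiedCoefficientSeed"
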